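import Mathlib
import Summits.MatrixMultiplication.MatrixMultiplication.Theorems.SnSubsetDichotomyPolynomialSlackHookCharacters

/-!
# The four Specht characters of level `2`: `(n-2,2)`, `(n-2,1,1)` and their transposes

Helper file for the LEVEL-TWO pinning identity on the crux `SnSubsetDichotomy.PolynomialSlack`
(stmt-MatrixMultiplication-8306): the characters of the Wedderburn blocks of `ℂ[S_n]` indexed by
`(n-2,2)`, `(n-2,1,1)` and (sign twists, `spechtCharacter_transpose`) their transposes, as integer
combinations of `c₁(σ) = #{p : σ p = p}`, `F₂(σ) = #{(p, q) : p ≠ q, σ p = p, σ q = q}` and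
`I₂(σ) = #{s : #s = 2, σ(s) ⊆ s}` (the classical character polynomials `C(c₁,2) + c₂ - c₁` and
`C(c₁-1,2) - c₂`, written without cycle types):

* `spechtCharacter_of_sortedParts_eq_twoRowTwo` — **`χ^{(n-2,2)}(σ) = I₂ - c₁`**;
* `spechtCharacter_of_sortedParts_eq_twoRowOneOne` — **`χ^{(n-2,1,1)}(σ) = F₂ - c₁ + 1 - I₂`**;
* `spechtCharacter_of_transpose_sortedParts_eq_twoRowTwo/twoRowOneOne` — the sign twists.

The proofs evaluate FROBENIUS'S FORMULA in word-count form with three variables (tree theorem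
`spechtCharacter_eq_sum_sign_mul_card`): `χ^λ(σ) = ∑_{τ ∈ S₃} sgn(τ) #{σ-invariant words
[n] → {0,1,2} of content λ + ρ - ρ ∘ τ⁻¹}`; the six contents are read off by
`frobeniusCondition_three_iff/false`, and the invariant words of a given content are counted by
`card_filter_words_twoLetter` (two letters `↔` invariant subsets) and `card_filter_words_oneOne`
(content `(n-2,1,1)` `↔` ordered pairs of fixed points).

References: W. Fulton, J. Harris, *Representation Theory*, GTM 129, (4.10) and Ex. 4.15;
G. James, A. Kerber, *The Representation Theory of the Symmetric Group*, 2.3.17.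
-/

namespace Summit.MatrixMultiplication.MatrixMultiplication.Theorems.PolynomialSlack

open Literature.NumberTheory.DiophantineGeometry Literature.RepresentationTheory.FiniteGroups
open Literature.RingTheory.SymmetricFunctions.SymmPoly (rho rho_apply)

-- `Summit.<Summit>.<Problem>` is the tree's mandated summit-side namespace (CONVENTIONS §2); for
-- this single-conjunct summit the two coincide, so each declaration silences `dupNamespace`.
set_option linter.dupNamespace false

/-! ## Invariant subsets and invariant words -/

section Words

variable {n : ℕ}

/-- A finite set mapped into itself by a permutation is mapped onto itself. [folklore] -/
theorem perm_mem_iff_of_invariant {α : Type*} (σ : Equiv.Perm α) {s : Finset α}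
    (hs : ∀ p ∈ s, σ p ∈ s) (p : α) : σ p ∈ s ↔ p ∈ s :=
  ⟨fun h => by simpa using Equiv.Perm.perm_symm_on_of_perm_on_finset hs h, hs p⟩

/-- The `σ`-invariant singletons are the fixed points of `σ`. [folklore] -/
theorem card_filter_powersetCard_one_invariant (σ : Equiv.Perm (Fin n)) :
    (((Finset.univ : Finset (Fin n)).powersetCard 1).filter fun s => ∀ p ∈ s, σ p ∈ s).card =
      (Finset.univ.filter fun p : Fin n => σ p = p).card := by
  rw [Finset.powersetCard_one, Finset.filter_map, Finset.card_map]
  congr 1; ext p; simp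

/-- The only `0`-subset is `∅`, and it is invariant. [folklore] -/
theorem card_filter_powersetCard_zero_invariant (σ : Equiv.Perm (Fin n)) :
    (((Finset.univ : Finset (Fin n)).powersetCard 0).filter fun s => ∀ p ∈ s, σ p ∈ s).card =
      1 := by
  rw [Finset.powersetCard_zero, Finset.filter_singleton, if_pos (by simp), Finset.card_singleton]

/-- The fibre of `a ≠ 0` of the indicator word of `s` (letter `a` on `s`, `0` elsewhere) is `s`.
[folklore] -/
theorem filter_indicatorWord_eq {N : ℕ} [NeZero N] {a : Fin N} (ha : a ≠ 0) (s : Finset (Fin n)) :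
    (Finset.univ.filter fun p : Fin n => (if p ∈ s then a else 0) = a) = s := by
  ext p
  simp only [Finset.mem_filter, Finset.mem_univ, true_and]
  by_cases hp : p ∈ s
  · rw [if_pos hp]; exact ⟨fun _ => hp, fun _ => rfl⟩
  · rw [if_neg hp]; exact ⟨fun h => absurd h.symm ha, fun h => absurd h hp⟩

/-- **Invariant words in two letters.** The `σ`-invariant words in the letters `0` and `a ≠ 0` with
exactly `k` letters `a` correspond, through the fibre of `a`, to the `σ`-invariant `k`-subsets.
[folklore] -/
theorem card_filter_words_twoLetter {N : ℕ} [NeZero N] (a : Fin N) (ha : a ≠ 0) (k : ℕ)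
    (σ : Equiv.Perm (Fin n)) :
    (Finset.univ.filter fun w : Word N n => w ∘ ⇑σ = w ∧
        (∀ j, j ≠ 0 → j ≠ a → wordContent w j = 0) ∧ wordContent w a = k).card =
      (((Finset.univ : Finset (Fin n)).powersetCard k).filter fun s => ∀ p ∈ s, σ p ∈ s).card := by
  refine Finset.card_nbij' (fun w => Finset.univ.filter fun p => w p = a)
    (fun s p => if p ∈ s then a else 0) ?_ ?_ ?_ ?_
  · -- the fibre of `a` is an invariant `k`-subset
    intro w hw
    rw [Finset.mem_coe, Finset.mem_filter] at hw
    obtain ⟨-, hσ, -, hk⟩ := hw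
    rw [Finset.mem_coe, Finset.mem_filter, Finset.mem_powersetCard]
    refine ⟨⟨Finset.subset_univ _, hk⟩, fun p hp => ?_⟩
    rw [Finset.mem_filter] at hp ⊢
    exact ⟨Finset.mem_univ _, (congrFun hσ p).trans hp.2⟩
  · -- the indicator word of an invariant `k`-subset is an invariant word of content `(n-k, k)`
    intro s hs
    rw [Finset.mem_coe, Finset.mem_filter, Finset.mem_powersetCard] at hs
    obtain ⟨⟨-, hcard⟩, hinv⟩ := hs
    have hiff := perm_mem_iff_of_invariant σ hinv
    rw [Finset.mem_coe, Finset.mem_filter]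
    refine ⟨Finset.mem_univ _, ?_, ?_, ?_⟩
    · funext p
      simp only [Function.comp_apply, hiff]
    · intro j hj0 hja
      rw [wordContent, Finset.card_eq_zero, Finset.filter_eq_empty_iff]
      intro p _
      beta_reduce
      split_ifs
      · exact fun h => hja h.symm
      · exact fun h => hj0 h.symm
    · rw [wordContent, filter_indicatorWord_eq ha, hcard]
  · -- word ↦ fibre ↦ word
    intro w hw
    rw [Finset.mem_coe, Finset.mem_filter] at hw
    obtain ⟨-, -, hzero, -⟩ := hw
    funext p
    simp only [Finset.mem_filter, Finset.mem_univ, true_and]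
    by_cases hp : w p = a
    · rw [if_pos hp, hp]
    · rw [if_neg hp]
      by_contra h0
      have := hzero (w p) (fun h => h0 h.symm) hp
      rw [wordContent, Finset.card_eq_zero, Finset.filter_eq_empty_iff] at this
      exact this (Finset.mem_univ p) rfl
  · -- subset ↦ word ↦ subset
    intro s _
    exact filter_indicatorWord_eq ha s

/-- Invariant words in the letters `0, 1` (three-letter alphabet) with `k` letters `1`. [folklore] -/
theorem card_filter_words_three_letterOne (k : ℕ) (σ : Equiv.Perm (Fin n)) :
    (Finset.univ.filter fun w : Word 3 n => w ∘ ⇑σ = w ∧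
        (wordContent w 1 = k ∧ wordContent w 2 = 0)).card =
      (((Finset.univ : Finset (Fin n)).powersetCard k).filter fun s => ∀ p ∈ s, σ p ∈ s).card := by
  rw [← card_filter_words_twoLetter (N := 3) 1 (by decide) k σ]
  refine congrArg Finset.card (Finset.filter_congr fun w _ => and_congr_right fun _ => ?_)
  exact ⟨fun ⟨h1, h2⟩ =>
      ⟨fun j hj0 hj1 => by fin_cases j; exacts [absurd rfl hj0, absurd rfl hj1, h2], h1⟩,
    fun ⟨h, h1⟩ => ⟨h1, h 2 (by decide) (by decide)⟩⟩

/-- Invariant words in the letters `0, 2` (three-letter alphabet) with `k` letters `2`. [folklore] -/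
theorem card_filter_words_three_letterTwo (k : ℕ) (σ : Equiv.Perm (Fin n)) :
    (Finset.univ.filter fun w : Word 3 n => w ∘ ⇑σ = w ∧
        (wordContent w 1 = 0 ∧ wordContent w 2 = k)).card =
      (((Finset.univ : Finset (Fin n)).powersetCard k).filter fun s => ∀ p ∈ s, σ p ∈ s).card := by
  rw [← card_filter_words_twoLetter (N := 3) 2 (by decide) k σ]
  refine congrArg Finset.card (Finset.filter_congr fun w _ => and_congr_right fun _ => ?_)
  exact ⟨fun ⟨h1, h2⟩ =>
      ⟨fun j hj0 hj2 => by fin_cases j; exacts [absurd rfl hj0, h1, absurd rfl hj2], h2⟩,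
    fun ⟨h, h2⟩ => ⟨h 1 (by decide) (by decide), h2⟩⟩

/-- **Invariant words of content `(n-2,1,1)`.** The `σ`-invariant words in three letters with exactly
one letter `1` and one letter `2` correspond to the ordered pairs of distinct fixed points of `σ`
(the positions of the two letters). [folklore] -/
theorem card_filter_words_oneOne (σ : Equiv.Perm (Fin n)) :
    (Finset.univ.filter fun w : Word 3 n => w ∘ ⇑σ = w ∧
        (wordContent w 1 = 1 ∧ wordContent w 2 = 1)).card =
      (Finset.univ.filter fun pq : Fin n × Fin n =>
        pq.1 ≠ pq.2 ∧ σ pq.1 = pq.1 ∧ σ pq.2 = pq.2).card := by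
  -- the word with the letter `1` at `p`, `2` at `q` and `0` elsewhere (`p ≠ q`)
  set ind : Fin n × Fin n → Word 3 n := fun pq r =>
    if r = pq.1 then 1 else if r = pq.2 then 2 else 0 with hind
  have hval : ∀ pq : Fin n × Fin n, pq.1 ≠ pq.2 → ∀ r,
      (ind pq r = 1 ↔ r = pq.1) ∧ (ind pq r = 2 ↔ r = pq.2) := by
    rintro ⟨p, q⟩ hne r
    simp only [hind]
    by_cases hrp : r = p
    · simp [hrp, hne]
    · by_cases hrq : r = q
      · simp [hrq, Ne.symm hne]
      · simp [hrp, hrq]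
  -- a letter of `{0, 1, 2}` is determined by whether it is `1` and whether it is `2`
  have hdet : ∀ x y : Fin 3, (x = 1 ↔ y = 1) → (x = 2 ↔ y = 2) → x = y := by decide
  symm
  refine Finset.card_bij (fun pq _ => ind pq) ?_ ?_ ?_
  · rintro ⟨p, q⟩ hpq
    simp only [Finset.mem_filter, Finset.mem_univ, true_and] at hpq ⊢
    obtain ⟨hne, hp, hq⟩ := hpq
    refine ⟨funext fun r => ?_, ?_, ?_⟩
    · have h1 : σ r = p ↔ r = p := ⟨fun h => σ.injective (h.trans hp.symm), fun h => by rw [h, hp]⟩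
      have h2 : σ r = q ↔ r = q := ⟨fun h => σ.injective (h.trans hq.symm), fun h => by rw [h, hq]⟩
      exact hdet _ _ ((hval (p, q) hne (σ r)).1.trans (h1.trans (hval (p, q) hne r).1.symm))
        ((hval (p, q) hne (σ r)).2.trans (h2.trans (hval (p, q) hne r).2.symm))
    · rw [wordContent, Finset.card_eq_one]
      exact ⟨p, Finset.ext fun r => by simpa using (hval (p, q) hne r).1⟩
    · rw [wordContent, Finset.card_eq_one]
      exact ⟨q, Finset.ext fun r => by simpa using (hval (p, q) hne r).2⟩
  · rintro ⟨p, q⟩ hpq ⟨p', q'⟩ hpq' heq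
    simp only [Finset.mem_filter, Finset.mem_univ, true_and] at hpq hpq'
    have heq' : ind (p, q) = ind (p', q') := heq
    have e1 : ind (p, q) p = 1 := (hval (p, q) hpq.1 p).1.2 rfl
    have e2 : ind (p, q) q = 2 := (hval (p, q) hpq.1 q).2.2 rfl
    rw [heq'] at e1 e2
    rw [(hval (p', q') hpq'.1 p).1.1 e1, (hval (p', q') hpq'.1 q).2.1 e2]
  · intro w hw
    simp only [Finset.mem_filter, Finset.mem_univ, true_and] at hw
    obtain ⟨hσ, h1, h2⟩ := hw
    rw [wordContent, Finset.card_eq_one] at h1 h2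
    obtain ⟨p, hp⟩ := h1
    obtain ⟨q, hq⟩ := h2
    have hp' : ∀ r, w r = 1 ↔ r = p := fun r => by simpa using Finset.ext_iff.1 hp r
    have hq' : ∀ r, w r = 2 ↔ r = q := fun r => by simpa using Finset.ext_iff.1 hq r
    have hwp : w p = 1 := (hp' p).2 rfl
    have hwq : w q = 2 := (hq' q).2 rfl
    have hne : p ≠ q := fun h => by rw [h, hwq] at hwp; exact absurd hwp (by decide)
    refine ⟨(p, q), ?_, funext fun r => ?_⟩
    · simp only [Finset.mem_filter, Finset.mem_univ, true_and]
      exact ⟨hne, (hp' (σ p)).1 ((congrFun hσ p).trans hwp),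
        (hq' (σ q)).1 ((congrFun hσ q).trans hwq)⟩
    · exact hdet _ _ ((hval (p, q) hne r).1.trans (hp' r).symm)
        ((hval (p, q) hne r).2.trans (hq' r).symm)

/-! ## Frobenius's formula with three variables -/

/-- The three contents of a word in three letters add up to its length. [folklore] -/
theorem wordContent_sum_three (w : Word 3 n) :
    wordContent w 0 + wordContent w 1 + wordContent w 2 = n := by
  have := sum_wordContent w
  rwa [Fin.sum_univ_three] at this

/-- **The counting condition of Frobenius's formula, three variables.** For a permutation `t` of the
letters with `ρ ∘ t = (r₀, r₁, r₂)` and `λ + ρ = (m₀, m₁, m₂)`, the condition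
`∀ j, ρ (t j) + c_j(w) = λ_j + ρ_j` on a word `w` of length `n` is a condition on its contents
`c₁(w), c₂(w)` alone (`c₀ = n - c₁ - c₂`), discharged by linear arithmetic: here it prescribes them.
[folklore] -/
theorem frobeniusCondition_three_iff (t : Equiv.Perm (Fin 3)) (r₀ r₁ r₂ : ℕ)
    (hr : rho 3 (t 0) = r₀ ∧ rho 3 (t 1) = r₁ ∧ rho 3 (t 2) = r₂) {L : List ℕ} {m₀ m₁ m₂ : ℕ}
    (hm : L.getD 0 0 + 2 = m₀ ∧ L.getD 1 0 + 1 = m₁ ∧ L.getD 2 0 = m₂) (v₁ v₂ : ℕ)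
    (H : ∀ c₀ c₁ c₂ : ℕ, c₀ + c₁ + c₂ = n →
      ((r₀ + c₀ = m₀ ∧ r₁ + c₁ = m₁ ∧ r₂ + c₂ = m₂) ↔ (c₁ = v₁ ∧ c₂ = v₂)))
    (σ : Equiv.Perm (Fin n)) (w : Word 3 n) :
    (w ∘ ⇑σ = w ∧ ∀ j, rho 3 (t j) + wordContent w j = L.getD j 0 + rho 3 j) ↔
      (w ∘ ⇑σ = w ∧ (wordContent w 1 = v₁ ∧ wordContent w 2 = v₂)) := by
  obtain ⟨h0, h1, h2⟩ := hr
  obtain ⟨hm0, hm1, hm2⟩ := hm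
  subst h0 h1 h2 hm0 hm1 hm2
  refine and_congr_right fun _ => Iff.trans ?_ (H _ _ _ (wordContent_sum_three w))
  -- `ρ = (ρ₀, ρ₁, ρ₂) = (2, 1, 0)` holds by `rfl`
  exact ⟨fun hj => ⟨hj 0, hj 1, hj 2⟩, fun hj j => by fin_cases j; exacts [hj.1, hj.2.1, hj.2.2]⟩

/-- **The counting condition of Frobenius's formula, three variables**: the case of an impossible
(negative) content. [folklore] -/
theorem frobeniusCondition_three_false (t : Equiv.Perm (Fin 3)) (r₀ r₁ r₂ : ℕ)
    (hr : rho 3 (t 0) = r₀ ∧ rho 3 (t 1) = r₁ ∧ rho 3 (t 2) = r₂) {L : List ℕ} {m₀ m₁ m₂ : ℕ}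
    (hm : L.getD 0 0 + 2 = m₀ ∧ L.getD 1 0 + 1 = m₁ ∧ L.getD 2 0 = m₂)
    (H : ∀ c₀ c₁ c₂ : ℕ, c₀ + c₁ + c₂ = n → ¬(r₀ + c₀ = m₀ ∧ r₁ + c₁ = m₁ ∧ r₂ + c₂ = m₂))
    (σ : Equiv.Perm (Fin n)) (w : Word 3 n) :
    (w ∘ ⇑σ = w ∧ ∀ j, rho 3 (t j) + wordContent w j = L.getD j 0 + rho 3 j) ↔ False := by
  obtain ⟨h0, h1, h2⟩ := hr
  obtain ⟨hm0, hm1, hm2⟩ := hm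
  subst h0 h1 h2 hm0 hm1 hm2
  exact iff_false_intro fun h => H _ _ _ (wordContent_sum_three w) ⟨h.2 0, h.2 1, h.2 2⟩

/-- The six permutations of three letters: `∑_{τ ∈ S₃} f(τ)` term by term. [folklore] -/
theorem sum_univ_perm_fin_three (f : Equiv.Perm (Fin 3) → ℂ) :
    ∑ τ, f τ = f 1 + f (Equiv.swap 0 1) + f (Equiv.swap 0 2) + f (Equiv.swap 1 2) +
      f (Equiv.swap 0 1 * Equiv.swap 1 2) + f (Equiv.swap 1 2 * Equiv.swap 0 1) := by
  have huniv : (Finset.univ : Finset (Equiv.Perm (Fin 3))) =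
      {1, Equiv.swap 0 1, Equiv.swap 0 2, Equiv.swap 1 2, Equiv.swap 0 1 * Equiv.swap 1 2,
        Equiv.swap 1 2 * Equiv.swap 0 1} := by decide
  rw [huniv, Finset.sum_insert (by decide), Finset.sum_insert (by decide),
    Finset.sum_insert (by decide), Finset.sum_insert (by decide), Finset.sum_insert (by decide),
    Finset.sum_singleton]
  ring

/-- The signs of the five non-identity permutations of three letters. [folklore] -/
theorem sign_perm_fin_three :
    Equiv.Perm.sign (Equiv.swap (0 : Fin 3) 1) = -1 ∧
      Equiv.Perm.sign (Equiv.swap (0 : Fin 3) 2) = -1 ∧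
      Equiv.Perm.sign (Equiv.swap (1 : Fin 3) 2) = -1 ∧
      Equiv.Perm.sign (Equiv.swap (0 : Fin 3) 1 * Equiv.swap 1 2) = 1 ∧
      Equiv.Perm.sign (Equiv.swap (1 : Fin 3) 2 * Equiv.swap 0 1) = 1 := by
  have h01 : Equiv.Perm.sign (Equiv.swap (0 : Fin 3) 1) = -1 := Equiv.Perm.sign_swap (by decide)
  have h02 : Equiv.Perm.sign (Equiv.swap (0 : Fin 3) 2) = -1 := Equiv.Perm.sign_swap (by decide)
  have h12 : Equiv.Perm.sign (Equiv.swap (1 : Fin 3) 2) = -1 := Equiv.Perm.sign_swap (by decide)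
  refine ⟨h01, h02, h12, ?_, ?_⟩ <;> rw [Equiv.Perm.sign_mul] <;> simp [h01, h12]

end Words

/-! ## The characters -/

section Characters

/-- **`χ^{(n-2,2)}(σ) = I₂(σ) - c₁(σ)`**: the number of `σ`-invariant `2`-subsets minus the number of
fixed points (Frobenius's formula with three variables: only `τ = 1`, content `(n-2, 2, 0)`, and
`τ = (0 1)`, content `(n-1, 1, 0)`, contribute). [folklore] -/
theorem spechtCharacter_of_sortedParts_eq_twoRowTwo {n : ℕ} (μ : Nat.Partition n) (hn : 4 ≤ n)
    (h : μ.sortedParts = [n - 2, 2]) (σ : Equiv.Perm (Fin n)) :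
    spechtCharacter ℂ μ σ =
      (((Finset.powersetCard 2 (Finset.univ : Finset (Fin n))).filter
          fun s => ∀ p ∈ s, σ p ∈ s).card : ℂ) -
        ((Finset.univ.filter fun p : Fin n => σ p = p).card : ℂ) := by
  have hN : μ.parts.card ≤ 3 := by
    rw [← μ.length_sortedParts, h]; simp
  have hm : μ.sortedParts.getD 0 0 + 2 = n ∧ μ.sortedParts.getD 1 0 + 1 = 3 ∧
      μ.sortedParts.getD 2 0 = 0 := by
    rw [h]
    refine ⟨?_, rfl, rfl⟩
    rw [List.getD_cons_zero]
    omega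
  rw [spechtCharacter_eq_sum_sign_mul_card μ hN σ, sum_univ_perm_fin_three,
    Finset.filter_congr fun w _ => frobeniusCondition_three_iff 1⁻¹ 2 1 0 (by decide) hm 2 0
      (by omega) σ w,
    Finset.filter_congr fun w _ => frobeniusCondition_three_iff (Equiv.swap 0 1)⁻¹ 1 2 0 (by decide)
      hm 1 0 (by omega) σ w,
    Finset.filter_congr fun w _ => frobeniusCondition_three_false (Equiv.swap 0 2)⁻¹ 0 1 2
      (by decide) hm (by omega) σ w,
    Finset.filter_congr fun w _ => frobeniusCondition_three_false (Equiv.swap 1 2)⁻¹ 2 0 1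
      (by decide) hm (by omega) σ w,
    Finset.filter_congr fun w _ => frobeniusCondition_three_false
      (Equiv.swap 0 1 * Equiv.swap 1 2)⁻¹ 0 2 1 (by decide) hm (by omega) σ w,
    Finset.filter_congr fun w _ => frobeniusCondition_three_false
      (Equiv.swap 1 2 * Equiv.swap 0 1)⁻¹ 1 0 2 (by decide) hm (by omega) σ w,
    card_filter_words_three_letterOne 2 σ, card_filter_words_three_letterOne 1 σ,
    card_filter_powersetCard_one_invariant σ]
  simp only [Finset.filter_false, Finset.card_empty, Nat.cast_zero, mul_zero, add_zero]
  rw [Equiv.Perm.sign_one, sign_perm_fin_three.1]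
  push_cast
  ring

/-- **`χ^{(n-2,1,1)}(σ) = F₂(σ) - c₁(σ) + 1 - I₂(σ)`** (ordered pairs of distinct fixed points, fixed
points, invariant `2`-subsets), by Frobenius's formula with three variables: `τ = 1` gives the
content `(n-2,1,1)` (count `F₂`), `τ = (0 1)` the content `(n-1,0,1)` (count `c₁`, sign `-`),
`τ = (1 2)` the content `(n-2,2,0)` (count `I₂`, sign `-`), the `3`-cycle `(0 1)(1 2)` the content
`(n,0,0)` (count `1`), and the two remaining permutations would need a negative content. [folklore] -/
theorem spechtCharacter_of_sortedParts_eq_twoRowOneOne {n : ℕ} (μ : Nat.Partition n) (hn : 4 ≤ n)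
    (h : μ.sortedParts = [n - 2, 1, 1]) (σ : Equiv.Perm (Fin n)) :
    spechtCharacter ℂ μ σ =
      ((Finset.univ.filter fun pq : Fin n × Fin n =>
          pq.1 ≠ pq.2 ∧ σ pq.1 = pq.1 ∧ σ pq.2 = pq.2).card : ℂ) -
        ((Finset.univ.filter fun p : Fin n => σ p = p).card : ℂ) + 1 -
        (((Finset.powersetCard 2 (Finset.univ : Finset (Fin n))).filter
          fun s => ∀ p ∈ s, σ p ∈ s).card : ℂ) := by
  have hN : μ.parts.card ≤ 3 := by
    rw [← μ.length_sortedParts, h]; simp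
  have hm : μ.sortedParts.getD 0 0 + 2 = n ∧ μ.sortedParts.getD 1 0 + 1 = 2 ∧
      μ.sortedParts.getD 2 0 = 1 := by
    rw [h]
    refine ⟨?_, rfl, rfl⟩
    rw [List.getD_cons_zero]
    omega
  rw [spechtCharacter_eq_sum_sign_mul_card μ hN σ, sum_univ_perm_fin_three,
    Finset.filter_congr fun w _ => frobeniusCondition_three_iff 1⁻¹ 2 1 0 (by decide) hm 1 1
      (by omega) σ w,
    Finset.filter_congr fun w _ => frobeniusCondition_three_iff (Equiv.swap 0 1)⁻¹ 1 2 0 (by decide)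
      hm 0 1 (by omega) σ w,
    Finset.filter_congr fun w _ => frobeniusCondition_three_false (Equiv.swap 0 2)⁻¹ 0 1 2
      (by decide) hm (by omega) σ w,
    Finset.filter_congr fun w _ => frobeniusCondition_three_iff (Equiv.swap 1 2)⁻¹ 2 0 1 (by decide)
      hm 2 0 (by omega) σ w,
    Finset.filter_congr fun w _ => frobeniusCondition_three_iff
      (Equiv.swap 0 1 * Equiv.swap 1 2)⁻¹ 0 2 1 (by decide) hm 0 0 (by omega) σ w,
    Finset.filter_congr fun w _ => frobeniusCondition_three_false
      (Equiv.swap 1 2 * Equiv.swap 0 1)⁻¹ 1 0 2 (by decide) hm (by omega) σ w,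
    card_filter_words_oneOne σ, card_filter_words_three_letterTwo 1 σ,
    card_filter_powersetCard_one_invariant σ, card_filter_words_three_letterOne 2 σ,
    card_filter_words_three_letterOne 0 σ, card_filter_powersetCard_zero_invariant σ]
  simp only [Finset.filter_false, Finset.card_empty, Nat.cast_zero, mul_zero, add_zero]
  rw [Equiv.Perm.sign_one, sign_perm_fin_three.1, sign_perm_fin_three.2.2.1,
    sign_perm_fin_three.2.2.2.1]
  push_cast
  ring

/-- **`χ^{(2,2,1^{n-4})}(σ) = sgn(σ) (I₂(σ) - c₁(σ))`** (sign twist of `χ^{(n-2,2)}`). [folklore] -/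
theorem spechtCharacter_of_transpose_sortedParts_eq_twoRowTwo {n : ℕ} (μ : Nat.Partition n)
    (hn : 4 ≤ n) (h : μ.transpose.sortedParts = [n - 2, 2]) (σ : Equiv.Perm (Fin n)) :
    spechtCharacter ℂ μ σ = ((Equiv.Perm.sign σ : ℤ) : ℂ) *
      ((((Finset.powersetCard 2 (Finset.univ : Finset (Fin n))).filter
          fun s => ∀ p ∈ s, σ p ∈ s).card : ℂ) -
        ((Finset.univ.filter fun p : Fin n => σ p = p).card : ℂ)) := by
  rw [← μ.transpose_transpose, spechtCharacter_transpose,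
    spechtCharacter_of_sortedParts_eq_twoRowTwo μ.transpose hn h σ]

/-- **`χ^{(3,1^{n-3})}(σ) = sgn(σ) (F₂(σ) - c₁(σ) + 1 - I₂(σ))`** (sign twist of `χ^{(n-2,1,1)}`).
[folklore] -/
theorem spechtCharacter_of_transpose_sortedParts_eq_twoRowOneOne {n : ℕ} (μ : Nat.Partition n)
    (hn : 4 ≤ n) (h : μ.transpose.sortedParts = [n - 2, 1, 1]) (σ : Equiv.Perm (Fin n)) :
    spechtCharacter ℂ μ σ = ((Equiv.Perm.sign σ : ℤ) : ℂ) *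
      (((Finset.univ.filter fun pq : Fin n × Fin n =>
          pq.1 ≠ pq.2 ∧ σ pq.1 = pq.1 ∧ σ pq.2 = pq.2).card : ℂ) -
        ((Finset.univ.filter fun p : Fin n => σ p = p).card : ℂ) + 1 -
        (((Finset.powersetCard 2 (Finset.univ : Finset (Fin n))).filter
          fun s => ∀ p ∈ s, σ p ∈ s).card : ℂ)) := by
  rw [← μ.transpose_transpose, spechtCharacter_transpose,
    spechtCharacter_of_sortedParts_eq_twoRowOneOne μ.transpose hn h σ]

end Characters

end Summit.MatrixMultiplication.MatrixMultiplication.Theorems.PolynomialSlack
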